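import Literature.NumberTheory.Sieve.Maynard2016NuProd
import Literature.NumberTheory.Sieve.Maynard2016ZetaRatio
import Literature.NumberTheory.Sieve.Maynard2016CoupledBox

/-!
# Maynard (2016), Lemma 6: the coupled kernel on the cube is `(1+o(1)) 𝔖 · M(ξ,ξ') M(τ,τ')` ((6.16)–(6.18), (6.20))

Trunk: AntSieve / parity (Maynard 2016 large-gaps ladder, named fact
`Literature.NumberTheory.Sieve.Maynard2016.Lemma6MainTerm` of `Maynard2016Lemma6Split.lean`).

J. Maynard, *Large gaps between primes*, Ann. of Math. 183 (2016) = arXiv:1408.5110, §6, proof of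
Lemma 6, displays (6.16)–(6.18) and (6.20): in the cube `|ξ|, |ξ'|, |τ|, |τ'| ≤ √log x` the Euler
product `K` of (6.10)–(6.11) equals
`(1+o(1)) (log x)^{-k} (log y)^{-k} 𝔖 ∏_ℓ (1+iξ_ℓ)(1+iξ'_ℓ)/(2+iξ_ℓ+iξ'_ℓ) ∏_ℓ (1+iτ_ℓ)(1+iτ'_ℓ)/(2+iτ_ℓ+iτ'_ℓ)`,
`𝔖 = ∏_{p≤w}(1−1/p)^{−2k} ∏_{w<p≤y}(1 − ω_{m,q}(p)/p)(1−1/p)^{−2k}` — **uniformly in `m`, `q`**.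
This file assembles the PROVED bricks `K = E·N·Z·Z'` (`Maynard2016CoupledProduct`), `E = 1+o(1)`
(`Maynard2016BadPrimes`), `N = (1+o(1)) singLarge` (`Maynard2016NuProd`), `(φ(W)/W log b)^k Z = M ∏R`,
`∏R = 1+o(1)` (`Maynard2016ZetaRatio`) and `singSmall = (φ(P_w)/P_w)^{−2k}` into the cube estimate
`Maynard2016.eventually_norm_kernel_sub_model_le` — the two-scale analogue of the tree's Polymath (kt)
`LcmEuler.eventually_norm_sub_pairModel_le`.

## References

* J. Maynard, *Large gaps between primes*, Ann. of Math. (2) 183 (2016), 915–933; arXiv:1408.5110,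
  §6, proof of Lemma 6, displays (6.16)–(6.18), (6.20). [Maynard2016LargeGaps]
* D. H. J. Polymath, *Variants of the Selberg sieve, and bounded intervals containing many primes*,
  Res. Math. Sci. 1 (2014), Art. 12; arXiv:1407.4897, proof of Lemma 4.1, (kt), p. 13. [Polymath8b2014]
-/

noncomputable section

open Filter Finset Real
open scoped BigOperators Topology

namespace Literature.NumberTheory.Sieve

namespace Maynard2016

open LcmEuler

/-! ### `singSmall = (φ(P_w)/P_w)^{−2k}` -/

/-- The prime factors of `P_w` are the primes `≤ ⌊w⌋`. [cite: Maynard2016LargeGaps, §4 (definition of P_w)] -/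
theorem primeFactors_Pw (x : ℕ) : (Pw x).primeFactors = (Finset.Iic ⌊wFun x⌋₊).filter Nat.Prime := by
  ext p
  rw [Nat.mem_primeFactors, Finset.mem_filter, Finset.mem_Iic]
  constructor
  · rintro ⟨hp, hdvd, -⟩
    exact ⟨by unfold Pw at hdvd; exact hp.dvd_primorial_iff.1 hdvd, hp⟩
  · rintro ⟨hle, hp⟩
    exact ⟨hp, by unfold Pw; exact hp.dvd_primorial_iff.2 hle, Pw_ne_zero x⟩

/-- `φ(P_w)/P_w = ∏_{p ≤ w} (1 − 1/p)`. [cite: Maynard2016LargeGaps, §6 display (6.15)] -/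
theorem totient_div_Pw_eq (x : ℕ) :
    (Nat.totient (Pw x) : ℝ) / Pw x = ∏ p ∈ (Finset.Iic ⌊wFun x⌋₊).filter Nat.Prime, (1 - 1 / (p : ℝ)) := by
  rw [totient_div_eq_prod (Pw_ne_zero x), primeFactors_Pw]
  exact Finset.prod_congr rfl fun p _ => by rw [one_div]

/-- **`singSmall k x = (φ(P_w)/P_w)^{−2k}`**. [cite: Maynard2016LargeGaps, §6 displays (6.15), (6.20)] -/
theorem singSmall_eq_inv_pow (k x : ℕ) :
    singSmall k x = (((Nat.totient (Pw x) : ℝ) / Pw x) ^ (2 * k))⁻¹ := by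
  rw [totient_div_Pw_eq, ← Finset.prod_pow, ← Finset.prod_inv_distrib]
  rfl

/-- `0 < φ(P_w)/P_w`. [cite: Maynard2016LargeGaps, §4 (definition of P_w)] -/
theorem totient_div_Pw_pos (x : ℕ) : 0 < (Nat.totient (Pw x) : ℝ) / Pw x :=
  div_pos (Nat.cast_pos.2 (Nat.totient_pos.2 (primorial_pos _))) (Nat.cast_pos.2 (primorial_pos _))

/-- `0 < singSmall`. [cite: Maynard2016LargeGaps, §6 display (6.20)] -/
theorem singSmall_pos (k x : ℕ) : 0 < singSmall k x := by
  rw [singSmall_eq_inv_pow]; exact inv_pos.2 (pow_pos (totient_div_Pw_pos x) _)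

/-! ### Two small lemmas -/

/-- `T` is monotone-affine in `τ`: `T(cτ) ≤ c T(τ)` for `c ≥ 1`. [cite: Maynard2016LargeGaps, §6 display (6.14)] -/
theorem epsTotal_mul_le (k k' p₀ : ℕ) (τ : ℝ) {c : ℝ} (hc : 1 ≤ c) (Bad : Finset ℕ) :
    epsTotal k k' p₀ (c * τ) Bad ≤ c * epsTotal k k' p₀ τ Bad := by
  unfold epsTotal
  have hC : 0 ≤ badConst k k' := by unfold badConst goodConst; positivity
  have hS : 0 ≤ ∑ p ∈ Bad, Real.log p / p :=
    Finset.sum_nonneg fun p _ => div_nonneg (Real.log_natCast_nonneg p) (Nat.cast_nonneg p)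
  have h6 : (0 : ℝ) ≤ 6 ^ (k + k') := by positivity
  have hA : 0 ≤ 2 * badConst k k' / p₀ := by positivity
  have hB : (0 : ℝ) ≤ 16 * (k' + k * k') := by positivity
  nlinarith [mul_nonneg h6 hA]

/-- `‖abcd − 1‖ ≤ 15δ` if each of `a, b, c, d` is within `δ ≤ 1` of `1`. [folklore] -/
private theorem norm_mul4_sub_one_le {a b c d : ℂ} {δ : ℝ} (hδ1 : δ ≤ 1) (ha : ‖a - 1‖ ≤ δ)
    (hb : ‖b - 1‖ ≤ δ) (hc : ‖c - 1‖ ≤ δ) (hd : ‖d - 1‖ ≤ δ) : ‖a * b * c * d - 1‖ ≤ 15 * δ := by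
  have hδ0 : 0 ≤ δ := (norm_nonneg _).trans ha
  have two : ∀ {u v : ℂ} {s t : ℝ}, 0 ≤ t → ‖u - 1‖ ≤ s → ‖v - 1‖ ≤ t →
      ‖u * v - 1‖ ≤ s * (1 + t) + t := by
    intro u v s t ht hu hv
    have e : u * v - 1 = (u - 1) * v + (v - 1) := by ring
    have hvn : ‖v‖ ≤ 1 + t := by
      have := norm_le_norm_add_norm_sub' v 1; rw [norm_one] at this; linarith [norm_sub_rev v 1]
    rw [e]
    refine (norm_add_le _ _).trans (add_le_add ?_ hv)
    rw [norm_mul]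
    exact mul_le_mul hu hvn (norm_nonneg _) ((norm_nonneg _).trans hu)
  have hab : ‖a * b - 1‖ ≤ 3 * δ := by have := two hδ0 ha hb; nlinarith
  have hcd : ‖c * d - 1‖ ≤ 3 * δ := by have := two hδ0 hc hd; nlinarith
  have := two (by positivity) hab hcd
  rw [show a * b * c * d = (a * b) * (c * d) by ring]
  nlinarith

/-! ### The cube estimate -/

/-- **(6.16)–(6.18): the coupled kernel on the cube, uniformly in `m, q`.**  For `0 < ε ≤ 1/2`, `k`,
`η > 0`: eventually in `x : ℕ`, for all `1 ≤ m ≤ x`, all primes `x/2 ≤ q ≤ x` and all frequencies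
`(ξ,ξ'), (τ,τ')` in the cube `InCube √(log x)`:
`‖(log x)^k (log y)^k K(ξ,ξ',τ,τ') − 𝔖° M(ξ,ξ') M(τ,τ')‖ ≤ η 𝔖° ‖M(ξ,ξ') M(τ,τ')‖`,
where `K = coupledFreqKernel (P_w) m (couplingSet) x y`, `M = pairModel` and
`𝔖° = singSmall k x · singLarge k ε x m q` (which is `> 0`).
[cite: Maynard2016LargeGaps, §6 displays (6.16)–(6.18)] -/
theorem eventually_norm_kernel_sub_model_le {ε : ℝ} (hε0 : 0 < ε) (hε : ε ≤ 1 / 2) (k : ℕ)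
    {η : ℝ} (hη : 0 < η) :
    ∀ᶠ x : ℕ in atTop, ∀ m q : ℕ, 1 ≤ m → m ≤ x → q.Prime → (x : ℝ) / 2 ≤ q → q ≤ x →
      0 < singSmall k x * singLarge k ε x m q ∧
      ∀ p : (Fin k → ℝ × ℝ) × (Fin k → ℝ × ℝ),
        InCube (Real.sqrt (Real.log x)) p.1 → InCube (Real.sqrt (Real.log x)) p.2 →
          ‖(Real.log x : ℂ) ^ k * (Real.log (y ε x) : ℂ) ^ k *
                coupledFreqKernel (Pw x) m (couplingSet k x m q) (x : ℝ) (y ε x) p -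
              ((singSmall k x * singLarge k ε x m q : ℝ) : ℂ) * (pairModel p.1 * pairModel p.2)‖ ≤
            η * (singSmall k x * singLarge k ε x m q) * ‖pairModel p.1 * pairModel p.2‖ := by
  have hε1 : ε < 1 := by linarith
  -- accuracy `δ` for each of the four factors
  set δ : ℝ := min 1 (η / 15) with hδ
  have hδpos : 0 < δ := lt_min one_pos (by positivity)
  have hδ1 : δ ≤ 1 := min_le_left _ _
  have hδη : 15 * δ ≤ η := by have := min_le_right 1 (η / 15); rw [← hδ] at this; linarith
  have hlogδ : 0 < Real.log (1 + δ) := Real.log_pos (by linarith)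
  set cτ : ℝ := 1 + 2 * π with hcτ
  have hcτ1 : 1 ≤ cτ := by rw [hcτ]; linarith [Real.pi_pos]
  have hcτ0 : 0 < cτ := by linarith
  filter_upwards [eventually_epsTotal_le hε1 k (div_pos hlogδ hcτ0),
    eventually_abs_nuProdReal_sub_singLarge_le hε0 hε k hδpos,
    eventually_norm_prod_zetaRatioW_sub_one_le (ι := Fin k) hε1 hδpos,
    eventually_le_p0 ((7 * k : ℕ) : ℝ), eventually_le_p0 (2 : ℝ), eventually_iteratedLogs,
    eventually_y_lt_half hε0 (by linarith), eventually_ge_atTop 16] with x hT hN hR hp07 hp02 hlogs hyx hx16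
  obtain ⟨hL, hL₂, hL₃, hL₃L₂, hL₂L, -, -⟩ := hlogs
  intro m q hm1 hm hq hqx2 hqx
  have hq2 : 2 ≤ q := hq.two_le
  have hqx' : q ≤ x := by exact_mod_cast hqx
  have h2k : 2 * k ≤ ⌊wFun x⌋₊ := by
    have h7 : ((7 * k : ℕ) : ℝ) ≤ (p0 x : ℝ) := hp07
    have : 7 * k ≤ p0 x := by exact_mod_cast h7
    unfold p0 at this; omega
  have hSL := singLarge_pos h2k ε m q
  have hSS := singSmall_pos k x
  refine ⟨mul_pos hSS hSL, ?_⟩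
  intro p hp1 hp2
  -- basic real quantities
  have hx0 : (0 : ℝ) < x := by exact_mod_cast (show 0 < x by omega)
  have hx1 : (1 : ℝ) < x := by exact_mod_cast (show 1 < x by omega)
  have hL0 : 0 < Real.log x := by linarith
  have hR1 : 1 ≤ Real.sqrt (Real.log x) := by
    rw [show (1 : ℝ) = Real.sqrt 1 from Real.sqrt_one.symm]; exact Real.sqrt_le_sqrt (by linarith)
  have hly : 0 < Real.log (y ε x) := by
    rw [log_y]; exact mul_pos (by linarith) (div_pos (mul_pos hL0 (by linarith)) (by linarith))
  have hy1 : 1 < y ε x := by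
    by_contra h
    exact absurd (Real.log_nonpos (Real.exp_pos _).le (not_lt.1 h)) (not_le.2 hly)
  have hyx' : y ε x ≤ x := by linarith
  have hlyx : Real.log (y ε x) ≤ Real.log x := Real.log_le_log (by linarith) hyx'
  have hW : Pw x ≠ 0 := Pw_ne_zero x
  -- names
  set M := couplingSet k x m q with hM
  set a := expA (x : ℝ) p.1 with ha
  set b := expB (x : ℝ) p.1 with hb
  set a' := expA (y ε x) p.2 with ha'
  set b' := expB (y ε x) p.2 with hb'
  -- (1) `K = E · N · Z · Z'`
  set σ : ℝ := 1 / Real.log x with hσ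
  have hσ0 : 0 < σ := by positivity
  have habσ : ∀ i, σ ≤ (a i).re ∧ σ ≤ (b i).re := fun i => by
    rw [ha, hb, (expA_re_expB_re (x : ℝ) p.1 i).1, (expA_re_expB_re (x : ℝ) p.1 i).2]
    exact ⟨hσ.le, hσ.le⟩
  have hab'σ : ∀ j, σ ≤ (a' j).re ∧ σ ≤ (b' j).re := fun j => by
    rw [ha', hb', (expA_re_expB_re (y ε x) p.2 j).1, (expA_re_expB_re (y ε x) p.2 j).2, hσ]
    exact ⟨one_div_le_one_div_of_le hly hlyx, one_div_le_one_div_of_le hly hlyx⟩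
  have hab0 : ∀ i, 0 ≤ (a i).re ∧ 0 ≤ (b i).re := fun i =>
    ⟨hσ0.le.trans (habσ i).1, hσ0.le.trans (habσ i).2⟩
  have hab'0 : ∀ j, 0 ≤ (a' j).re ∧ 0 ≤ (b' j).re := fun j =>
    ⟨hσ0.le.trans (hab'σ j).1, hσ0.le.trans (hab'σ j).2⟩
  have hp2' : 2 ≤ p0 x := by exact_mod_cast hp02
  have hp7' : 7 * Fintype.card (Fin k) ≤ p0 x := by
    rw [Fintype.card_fin]; exact_mod_cast hp07
  have hWp : ∀ r : ℕ, r.Prime → ¬ r ∣ Pw x → p0 x ≤ r := fun r hr h => p0_le_of_not_dvd_Pw hr h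
  set τ : ℝ := (2 + 4 * π) * Real.sqrt (Real.log x) / Real.log (y ε x) with hτ
  have hτ0 : 0 ≤ τ := by rw [hτ]; positivity
  have haτ : ∀ i, ‖a i‖ ≤ τ := fun i =>
    (norm_sOf_div_le_of_inCube hR1 hly hlyx hp1 i).1
  have ha'τ : ∀ j, ‖a' j‖ ≤ τ := fun j =>
    (norm_sOf_div_le_of_inCube hR1 hly le_rfl hp2 j).1
  have hBad : ∀ r : ℕ, r.Prime → ¬ r ∣ Pw x → r ∉ badPrimes k x m q → ¬ r ∣ m ∧ M r = ∅ :=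
    fun r hr _ hB => badPrimes_spec hm1 hq2 r hr hB
  have hK : coupledFreqKernel (Pw x) m M (x : ℝ) (y ε x) p =
      coupledEpsProd (Pw x) m M a b a' b' * nuProd (Pw x) m M (badPrimes k x m q) *
        (zetaLimit (Pw x) a b * zetaLimit (Pw x) a' b') :=
    coupledKernel_eq_prod hW M hσ0 habσ hab'σ hp2' hp7' hp7' hWp hτ0 haτ ha'τ hBad
  -- (2) `‖E − 1‖ ≤ δ`
  set E := coupledEpsProd (Pw x) m M a b a' b' with hE
  have hE1 : ‖E - 1‖ ≤ δ := by
    have h := norm_coupledEpsProd_sub_one_le hab0 hab'0 hp2' hp7' hp7' hWp hτ0 haτ ha'τ hBad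
    rw [Fintype.card_fin] at h
    refine h.trans ?_
    have hτ' : τ = cτ * tauX ε x := by rw [hτ, hcτ]; unfold tauX; ring
    have hT' : epsTotal k k (p0 x) τ (badPrimes k x m q) ≤ Real.log (1 + δ) := by
      rw [hτ']
      refine (epsTotal_mul_le k k (p0 x) (tauX ε x) hcτ1 _).trans ?_
      have := hT m q hm1 hm hq2 hqx'
      calc cτ * epsTotal k k (p0 x) (tauX ε x) (badPrimes k x m q) ≤ cτ * (Real.log (1 + δ) / cτ) :=
            mul_le_mul_of_nonneg_left this hcτ0.le
        _ = Real.log (1 + δ) := mul_div_cancel₀ _ hcτ0.ne'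
    calc Real.exp (epsTotal k k (p0 x) τ (badPrimes k x m q)) - 1 ≤ Real.exp (Real.log (1 + δ)) - 1 := by
          gcongr
      _ = δ := by rw [Real.exp_log (by linarith)]; ring
  -- (3) `N = ν · singLarge` with `‖ν − 1‖ ≤ δ`
  obtain ⟨-, hNabs⟩ := hN m q hm1 hm hq hqx2 hqx
  set ν : ℂ := ((nuProdReal k x m q / singLarge k ε x m q : ℝ) : ℂ) with hν
  have hNc : nuProd (Pw x) m M (badPrimes k x m q) = ν * (singLarge k ε x m q : ℂ) := by
    rw [hM, nuProd_eq_ofReal, hν]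
    push_cast
    rw [div_mul_cancel₀ _ (by exact_mod_cast hSL.ne')]
  have hν1 : ‖ν - 1‖ ≤ δ := by
    rw [hν, show (((nuProdReal k x m q / singLarge k ε x m q : ℝ)) : ℂ) - 1 =
      (((nuProdReal k x m q - singLarge k ε x m q) / singLarge k ε x m q : ℝ) : ℂ) by
        push_cast; rw [sub_div, div_self (by exact_mod_cast hSL.ne')],
      Complex.norm_real, Real.norm_eq_abs, abs_div, abs_of_pos hSL, div_le_iff₀ hSL]
    exact hNabs
  -- (4) the two `ζ`-products: `(c log x)^k Z = M₁ R₁`, `(c log y)^k Z' = M₂ R₂`, `‖Rᵢ − 1‖ ≤ δ`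
  obtain ⟨hN1, hR1⟩ := hR (x : ℝ) hlyx p.1 hp1
  obtain ⟨hN2, hR2⟩ := hR (y ε x) le_rfl p.2 hp2
  set c : ℝ := (Nat.totient (Pw x) : ℝ) / Pw x with hc
  have hc0 : 0 < c := totient_div_Pw_pos x
  have hZ1 := pow_mul_zetaLimit_eq_pairModel hW hx1 p.1 hN1
  have hZ2 := pow_mul_zetaLimit_eq_pairModel hW hy1 p.2 hN2
  rw [Fintype.card_fin] at hZ1 hZ2
  set R₁ := ∏ j, zetaRatioW (Pw x) (Real.log x) (p.1 j) with hR₁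
  set R₂ := ∏ j, zetaRatioW (Pw x) (Real.log (y ε x)) (p.2 j) with hR₂
  set Z₁ := zetaLimit (Pw x) a b with hZ₁
  set Z₂ := zetaLimit (Pw x) a' b' with hZ₂
  set M₁ := pairModel p.1 with hM₁
  set M₂ := pairModel p.2 with hM₂
  -- `singSmall · c^{2k} = 1`
  have hSc : (singSmall k x : ℂ) * (c : ℂ) ^ (2 * k) = 1 := by
    have : singSmall k x * c ^ (2 * k) = 1 := by
      rw [singSmall_eq_inv_pow, ← hc, inv_mul_cancel₀ (pow_ne_zero _ hc0.ne')]
    exact_mod_cast this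
  -- (5) algebra: `X − T = 𝔖° M₁ M₂ (E ν R₁ R₂ − 1)`
  have hZ1' : ((c : ℂ) * (Real.log x : ℂ)) ^ k * Z₁ = M₁ * R₁ := by
    rw [hZ₁, ha, hb, hM₁, hR₁, ← hZ1, hc]; push_cast; ring
  have hZ2' : ((c : ℂ) * (Real.log (y ε x) : ℂ)) ^ k * Z₂ = M₂ * R₂ := by
    rw [hZ₂, ha', hb', hM₂, hR₂, ← hZ2, hc]; push_cast; ring
  have hX : (Real.log x : ℂ) ^ k * (Real.log (y ε x) : ℂ) ^ k *
        coupledFreqKernel (Pw x) m M (x : ℝ) (y ε x) p -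
      ((singSmall k x * singLarge k ε x m q : ℝ) : ℂ) * (M₁ * M₂) =
      ((singSmall k x * singLarge k ε x m q : ℝ) : ℂ) * (M₁ * M₂) * (E * ν * R₁ * R₂ - 1) := by
    rw [hK, hNc, Complex.ofReal_mul]
    linear_combination ((Real.log x : ℂ) ^ k * (Real.log (y ε x) : ℂ) ^ k * E * (ν * (singLarge k ε x m q : ℂ)) * Z₁ * Z₂) * hSc.symm
      + ((singSmall k x : ℂ) * E * ν * (singLarge k ε x m q : ℂ) * ((c : ℂ) * (Real.log (y ε x) : ℂ)) ^ k * Z₂) * hZ1'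
      + ((singSmall k x : ℂ) * E * ν * (singLarge k ε x m q : ℂ) * M₁ * R₁) * hZ2'
  rw [hX, norm_mul, norm_mul, Complex.norm_real, Real.norm_eq_abs, abs_of_pos (mul_pos hSS hSL)]
  have h4 : ‖E * ν * R₁ * R₂ - 1‖ ≤ 15 * δ := norm_mul4_sub_one_le hδ1 hE1 hν1 hR1 hR2
  have hS0 : 0 ≤ singSmall k x * singLarge k ε x m q * ‖M₁ * M₂‖ := by positivity
  calc singSmall k x * singLarge k ε x m q * ‖M₁ * M₂‖ * ‖E * ν * R₁ * R₂ - 1‖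
      ≤ singSmall k x * singLarge k ε x m q * ‖M₁ * M₂‖ * (15 * δ) :=
        mul_le_mul_of_nonneg_left h4 hS0
    _ ≤ singSmall k x * singLarge k ε x m q * ‖M₁ * M₂‖ * η := mul_le_mul_of_nonneg_left hδη hS0
    _ = η * (singSmall k x * singLarge k ε x m q) * ‖M₁ * M₂‖ := by ring

end Maynard2016

end Literature.NumberTheory.Sieve

end
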